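import Summits.BirchSwinnertonDyer.Rank1Residual.AdditivePotMult.PotMultRankOneKatoCertificateBSD
import Summits.BirchSwinnertonDyer.Rank1Residual.Additive.BranchPAdicGrossZagierUpperHalf
import Summits.BirchSwinnertonDyer.Rank1Residual.Additive.CensusX42BSD
import HarnessLib

/-!
# X4(M) at analytic rank ONE, EVERY odd `p` (`p = 3` included): on the unit-certified rows the typed
# (M) `p`-adic Gross–Zagier `BranchPAdicGrossZagierMultAt W p Dh` IS `BSD(E,p)` — the CERTIFICATE
# version of the iff, NO main conjecture (cell `b2b-bsdres`, team n1011, seat p17 gen 2, lead GEN 6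
# deal R5-26 (S6); the (M) twin of additive-p2 gen 19's `GordRankOneKatoBranchGrossZagier.lean` §2–§3,
# over n1011-p07's T-O7KM `PotMultRankOneKatoCertificate{,BSD}.lean` and n1011-p01's T-O7 / T-O7c
# `PotMultBranchPAdicGrossZagier{,RankOne,Converse}.lean`, `BranchPAdicGrossZagierUpperHalf.lean`)

HONEST FRAMING (cell `b2b-bsdres`, run/shared/lean/b2b/bsd-rank1-residual/, verbatim in every
file): the goal of the cell is to DELETE the COMBINATION-SHAPED residual classes of the
Birch–Swinnerton-Dyer formula for ALL analytic-rank `≤ 1` elliptic curves over `ℚ` — "full BSD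
formula for every rank `≤ 1` curve in class `C`" assembled STRICTLY from published theorems — so
that the rank-`≤ 1` remainder becomes exactly the CONSTRUCTION-SHAPED classes, which are TYPED
(missing-input `Prop`s), NOT attempted. This is not "finishing BSD". Team n1011 (RESIDUAL-MAP §I
O7-ord, (M) share: X4(M) ∧ surj(p) ∧ `r_an = 1`, every odd `p`): prove what is provable now; shrink
each hard class to its core with data; no claim beyond stated classes; research routes; census output
= EVIDENCE / conjecture items, never a Literature fact; RESIDUAL-MAP marks change only by signed
lines. X4(M) stays CONSTRUCTION-SHAPED; §I O7 stays OPEN; nothing here is booked; no label changes.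
THEOREMS ONLY (NO definition, NO Literature fact, NO `_holds`); named facts enter as HYPOTHESES:
`hK` = the semistable big-image half-eigenspace reading of Kato 2004 Thm. 17.4 (3)
(`Wuthrich2014.kato_halfEigenCharIdeal_dvd_cyclotomicPrime_of_surjective`, PUBLISHED), `hDelM` =
Delbourgo 2002 (A)+(B) in case (M) (`Delbourgo2002.mainTheorem_potMult`, A190 — ONLY in the §4
`exists_/forall_` forms that PRODUCE a (B)-datum), `hPal` = Pal 2012 Thm. 3.2 (ONLY in the §5 one-number
headline, carried exactly where p07's §7 shape carries it), GZK (`hGZK`), modularity (`hmod`, `hmodD`).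
The TYPED input is n1011-p01's `BranchPAdicGrossZagierMultAt W p Dh` (`@[conjecture]` def, PROVED in
rank `0`, OPEN in rank `1`); the certificate is n1011-p07's `MultBranchUnitCertificateAt W p` (ONE
finite `p`-adic computation per pair — EVIDENCE when instantiated). `#print axioms` standard.

COVERAGE (stated first, referee 1 proviso): per pair, `W/ℚ` globally minimal, `ClassX4M W p` (`E`
additive at the ODD prime `p`, `E[p]` irreducible, potentially MULTIPLICATIVE: `ord_p j < 0`; `p ≠ 2`
is part of `ClassX4`), `ρ̄_{E,p}` onto, `ord_{s=1} L(E,s) = 1`; BOTH parities of `(p−1)/2` at once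
(`p* = (−1)^{(p−1)/2} p`; `p = 3` INCLUDED); `E♭ = V` split or non-split multiplicative. Versus the
(G-ord) template: NO `5 ≤ p`, NO `¬ W.HasCM`, NO `ReductionNonAnomalous` (`ℓ_p = 1` AUTOMATIC on (M)),
NO `p % 4` binder, NO tower binder (tower of `E♭` from surj(p): multiplicative Lemma 20, inside p07's
theorems). NOT covered: the reducible-image rows X3♯(M) (n1011-p12's T-O7KM-X3); anything booked.

ANTI-COLLISION OF RECORD (lead GEN 6 R5-26): n1011-p01 = the IMC-version iffs on (M) (typed LOWER +
pGZ ⟹ LOWER half; BSD_p + typed LOWER + Kato ⟹ pGZ; Kato + pGZ + rider ⟹ UPPER half: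
`ClassX4M.missingLowerBoundAt_rankOne_of_quadraticBranchLower_of_branchPAdicGrossZagierMult`,
`…branchPAdicGrossZagierMultAt_of_bsdp_of_quadraticBranchLower_of_katoHalf`,
`…missingUpperBoundAt_rankOne_of_katoHalf_of_branchPAdicGrossZagierMult`, and the IMC-version iff
`…bsdp_iff_forall_branchPAdicGrossZagierMultAt_of_quadraticBranchLower_of_katoHalf` of
`BranchPAdicGrossZagierIff.lean`); THIS FILE = the CERT-version iffs (Kato half + p07's unit certificate,
NO `QuadraticBranchLowerDivisibilityAt`, NO rider: Schneider is PROVED by p07's §4). Disjoint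
hypotheses; shared steps consumed BY NAME, nothing re-derived.

## What

* §1 **`ClassX4M.bsdp_rankOne_of_katoHalf_of_multCert_of_branchPAdicGrossZagierMult`**: Kato's half +
  the certificate + `BranchPAdicGrossZagierMultAt W p Dh` for ONE (B)-datum `Dh` ⟹ **`BSD(E,p)`** —
  no main conjecture: the certificate pins `ord_p(ϖ·[T¹]B) = 0`, so pGZ reads `1 = ord_p q +
  ord_p Reg_p(E,Dh)` (`ord_p log_p γ = 1`, Schneider from p07 §4), which is p07's criterion
  `ClassX4M.bsdp_iff_padicVal_rankOne_of_katoHalf_of_multCert`.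
* §2 **`ClassX4M.branchPAdicGrossZagierMultAt_of_bsdp_of_katoHalf_of_multCert`**: conversely `BSD(E,p)`
  gives `ord_p(q·Reg_p(Dh)) = 1 = ord_p(ϖ·[T¹]B·log_p γ)` for EVERY admissible `(V, C, f, B, ϖ)`, so
  the quotient is a unit of `ℤ_p`: **`BSD(E,p)` ⟹ `BranchPAdicGrossZagierMultAt W p Dh` for EVERY
  (B)-datum** — CERT version (p01's converse takes the branch IMC instead).
* §3 **`ClassX4M.branchPAdicGrossZagierMultAt_iff_bsdp_of_katoHalf_of_multCert`** (per (B)-datum) and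
  `ClassX4M.forall_branchPAdicGrossZagierMultAt_iff_bsdp_of_katoHalf_of_multCert`: on the unit-certified
  X4(M) ∧ surj ∧ `r_an = 1` rows the typed (M) `p`-adic Gross–Zagier formula and the `p`-part of BSD are
  ONE statement (both OPEN in rank one; census Q6 / X4-2 measure exactly this valuation).
* §4 with Delbourgo 2002 (M) SUPPLYING the (B)-datum (`hDelM`, n1011-p16's bridge `ClassX4M.delbourgo2002`,
  no CM binder on (M)): `ClassX4M.bsdp_iff_{forall,exists}_branchPAdicGrossZagierMultAt_of_katoHalf_of_multCert`.
* §5 ONE-NUMBER headline `ClassX4M.branchPAdicGrossZagierMultAt_iff_bsdp_of_katoHalf_of_norm_coeff_one`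
  (certificate from p07's `multBranchUnitCertificateAt_of_norm_coeff_one`; `hPal` carried as there).

What is NOT claimed: `BranchPAdicGrossZagierMultAt` in rank one (OPEN); the certificate (per pair,
numerical); X3♯(M); anything booked. Labels UNCHANGED; O7 OPEN. References: [Kato2004Asterisque]
Thm. 17.4 (3) (p. 273); [Wuthrich2014] §3, Cor. 19, Lemma 20; [Delbourgo2002] Thm. (A), (B) (p. 40);
[Delbourgo1998] Thm. 1 (shape); [MazurTateTeitelbaum1986Invent] §I.10, §I.13–I.14; [Pal2012] Thm. 3.2;
[Miller2011LMS] Def. 1.1. Cell files: cells/n1011/OWNERS.md, cells/n1011/skel/T-S6-M-certiff.md.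
-/

noncomputable section

open scoped Classical MatrixGroups ModularForm NumberField

namespace Summit.BirchSwinnertonDyer.Rank1Residual.AdditivePotMult

open CongruenceSubgroup WeierstrassCurve NumberField Literature.NumberTheory.EllipticCurves
  Literature.NumberTheory.EllipticCurves.ModularForms
  Literature.NumberTheory.EllipticCurves.Rank1Residual
  Literature.NumberTheory.EllipticCurves.Rank1Residual.Typed
  Literature.NumberTheory.EllipticCurves.Delbourgo2002
  Literature.NumberTheory.GaloisRepresentations
  Summit.BirchSwinnertonDyer.Rank1Residual.Additive
  Summit.BirchSwinnertonDyer.Rank1Residual.X1.MuLambda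
  Summit.BirchSwinnertonDyer.Rank1Residual.X1.RankOneParitySqueeze
  IsDedekindDomain

variable {W : WeierstrassCurve ℚ} [W.IsElliptic] [W.IsGloballyMinimal] {p : ℕ} [hp : Fact p.Prime]

/-! ### §0 The certificate on the typed input's disjunction (valuation facts: the tree's
`X2.valuation_padicLog_cyclotomicGenerator`, `CensusX42.valuation_eq_zero_of_norm_eq_one`) -/

omit [W.IsElliptic] [W.IsGloballyMinimal] in
/-- **The certificate read on a branch series of the typed input's disjunction.** For a multiplicative
twist model `C • V^{(p*)} = W`, a newform `f` of `V`, a series `B` in the (M) reduction disjunction of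
`BranchPAdicGrossZagierMultAt` (`a_p = 1` split / `a_p = −1` non-split) and the period ratio `ϖ` of
the parity of `(p−1)/2`, the certificate `MultBranchUnitCertificateAt W p` gives
`‖ϖ·[T¹]B‖_p = 1` (`a_p(f) = ±1` by `IsNewformOf.cuspCoeff_eq_one_and_sq_of_split` /
`…_eq_neg_one_and_dvd_of_nonsplit`). [cite: MazurTateTeitelbaum1986Invent, §I.10, §I.13–I.14] -/
theorem norm_coeff_one_eq_one_of_multCert_of_disj (hcert : MultBranchUnitCertificateAt W p)
    (V : WeierstrassCurve ℚ) [V.IsElliptic] [V.IsGloballyMinimal] (C : VariableChange ℚ)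
    (hC : C • V.quadraticTwist ((-1 : ℚ) ^ (p / 2) * p) = W)
    {N : ℕ} [NeZero N] {f : CuspForm (Gamma0 N) 2} (hf : IsNewformOf V f) (B : PowerSeries ℚ_[p])
    (hVB : (V.HasSplitMultiplicativeReductionAtPrime p ∧
        B = if Even (p / 2) then padicLFunctionPlusBranchMult f (1 : ℚ_[p]) (p / 2)
          else padicLFunctionMinusBranchMult f (1 : ℚ_[p]) (p / 2)) ∨
      (V.HasMultiplicativeReductionAtPrime p ∧ ¬ V.HasSplitMultiplicativeReductionAtPrime p ∧
        B = if Even (p / 2) then padicLFunctionPlusBranchMult f (-1 : ℚ_[p]) (p / 2)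
          else padicLFunctionMinusBranchMult f (-1 : ℚ_[p]) (p / 2)))
    (ϖ : ℚ) (hϖ : if Even (p / 2) then (ϖ : ℝ) * V.realPeriodRat = plusPeriod f
      else (ϖ : ℝ) * V.imaginaryPeriodRat = minusPeriod f) :
    ‖((ϖ : ℚ) : ℚ_[p]) * PowerSeries.coeff 1 B‖ = 1 := by
  rcases hVB with ⟨hs, hBe⟩ | ⟨hV, hs, hBe⟩
  · obtain ⟨hap, -⟩ := hf.cuspCoeff_eq_one_and_sq_of_split hs
    obtain ⟨-, h1⟩ := hcert V C hs.hasMultiplicativeReductionAtPrime hC f hf 1 (by exact_mod_cast hap)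
      ϖ hϖ
    rw [Int.cast_one, PowerSeries.coeff_C_mul, ← hBe] at h1
    exact h1
  · obtain ⟨hap, -⟩ := hf.cuspCoeff_eq_neg_one_and_dvd_of_nonsplit hV hs
    obtain ⟨-, h1⟩ := hcert V C hV hC f hf (-1) (by exact_mod_cast hap) ϖ hϖ
    rw [Int.cast_neg, Int.cast_one, PowerSeries.coeff_C_mul, ← hBe] at h1
    exact h1

/-! ### §1 Kato + certificate + typed (M) `p`-adic Gross–Zagier for ONE (B)-datum ⟹ `BSD(E,p)` -/

omit [W.IsGloballyMinimal] in
/-- **X4(M) ∩ {`ρ̄_{E,p}` onto}, EVERY odd `p` (`p = 3` included), `r_an = 1`, UNIT certificate: Kato's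
divisibility and the typed (M) `p`-adic Gross–Zagier for ONE (B)-datum give `BSD(E,p)`** — no main
conjecture, no `ℓ`, no CM / `p ≥ 5` / non-anomalous binder: the certificate makes `ord_p(ϖ·[T¹]B) = 0`
on the discharged twist datum (`E♭`, its newform, the branch series of its reduction sign, the period
ratio of the parity), pGZ then reads `1 = ord_p q + ord_p Reg_p(E,Dh)` (Schneider's `Reg_p ≠ 0` is
p07's §4 theorem), which is p07's criterion `ClassX4M.bsdp_iff_padicVal_rankOne_of_katoHalf_of_multCert`.
[cite: Kato2004Asterisque, Thm. 17.4 (3) (p. 273)] [cite: Delbourgo2002, Theorem (B) (p. 40)]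
[cite: Delbourgo1998, Thm. 1 and §2.5 (shape only)] [cite: Miller2011LMS, Def. 1.1] -/
theorem ClassX4M.bsdp_rankOne_of_katoHalf_of_multCert_of_branchPAdicGrossZagierMult
    (hK : Wuthrich2014.kato_halfEigenCharIdeal_dvd_cyclotomicPrime_of_surjective)
    (hmodD : nonempty_modularParametrizationData)
    (hGZK : rank_eq_analyticRank_of_analyticRank_le_one) (hmod : hasEntireLFunction_rat)
    (hX : ClassX4M W p) (hsurj : Surj W p) (hr : W.analyticRank = 1)
    (hcert : MultBranchUnitCertificateAt W p)
    {Dh : PAdicHeightData W p} (hB : LeadingTermClauses W p Dh)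
    (hGZ : BranchPAdicGrossZagierMultAt W p Dh) : BSDp W p := by
  have hp2 : p ≠ 2 := hX.p_ne_two
  -- the twist datum, discharged
  obtain ⟨V, iV, iVm, C, hV, hC⟩ := hX.exists_mult_pStar_twist_model
  haveI : NeZero (V.conductorNorm ℤ) := ⟨(V.conductorNorm_pos_holds).ne'⟩
  obtain ⟨Dm⟩ := hmodD V
  obtain ⟨ϖ, hϖ⟩ := exists_periodRatio_parity (p := p) V Dm
  obtain ⟨B, hVB⟩ : ∃ B : PowerSeries ℚ_[p],
      (V.HasSplitMultiplicativeReductionAtPrime p ∧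
          B = if Even (p / 2) then padicLFunctionPlusBranchMult Dm.f (1 : ℚ_[p]) (p / 2)
            else padicLFunctionMinusBranchMult Dm.f (1 : ℚ_[p]) (p / 2)) ∨
        (V.HasMultiplicativeReductionAtPrime p ∧ ¬ V.HasSplitMultiplicativeReductionAtPrime p ∧
          B = if Even (p / 2) then padicLFunctionPlusBranchMult Dm.f (-1 : ℚ_[p]) (p / 2)
            else padicLFunctionMinusBranchMult Dm.f (-1 : ℚ_[p]) (p / 2)) := by
    by_cases hs : V.HasSplitMultiplicativeReductionAtPrime p
    · exact ⟨_, Or.inl ⟨hs, rfl⟩⟩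
    · exact ⟨_, Or.inr ⟨hV, hs, rfl⟩⟩
  -- the certificate: `ord_p(ϖ·[T¹]B) = 0`
  obtain ⟨hx0, hxv⟩ := CensusX42.valuation_eq_zero_of_norm_eq_one (p := p)
    (norm_coeff_one_eq_one_of_multCert_of_disj hcert V C hC Dm.isNewformOf B hVB ϖ hϖ)
  -- pGZ at rank one
  obtain ⟨hmw, -⟩ := hGZK W (by rw [hr])
  have hr1 : W.mordellWeilRank = 1 := by rw [hmw, hr]
  obtain ⟨u, q, hLq, hgz⟩ := hGZ V B hp2 ⟨C, hC⟩ hVB Dm.isNewformOf ϖ hϖ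
  rw [hr1, pow_one] at hgz
  -- Schneider PROVED (p07 §4) and `q ≠ 0` (modularity)
  have hReg : padicRegulator Dh ≠ 0 :=
    (hX.schneider_and_padicVal_identity_rankOne_of_katoHalf_of_multCert hK hmodD hGZK hsurj hr hcert
      hB).1
  have hq0 : q ≠ 0 := by
    rintro rfl
    rw [Rat.cast_zero, zero_mul, zero_mul] at hLq
    exact W.leadingLCoeff_ne_zero_holds (hmod W) hLq
  have hqQ : ((q : ℚ) : ℚ_[p]) ≠ 0 := by exact_mod_cast hq0
  have hu0 : ((u : ℤ_[p]) : ℚ_[p]) ≠ 0 := coe_units_ne_zero p u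
  obtain ⟨hlog0, hlogv⟩ := X2.valuation_padicLog_cyclotomicGenerator (p := p) hp2
  -- valuations of both sides of pGZ
  have hval := congrArg Padic.valuation hgz
  rw [Padic.valuation_mul hx0 hlog0, hxv, hlogv, Padic.valuation_mul (mul_ne_zero hu0 hqQ) hReg,
    Padic.valuation_mul hu0 hqQ, valuation_coe_units_eq_zero, zero_add, Padic.valuation_ratCast] at hval
  exact (hX.bsdp_iff_padicVal_rankOne_of_katoHalf_of_multCert hK hmodD hGZK hmod hsurj hr hcert hB
    hLq).mpr (by linarith)

/-! ### §2 `BSD(E,p)` ⟹ the typed (M) `p`-adic Gross–Zagier for EVERY (B)-datum (CERT version) -/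

omit [W.IsGloballyMinimal] in
/-- **X4(M) ∩ {`ρ̄_{E,p}` onto}, EVERY odd `p`, `r_an = 1`, UNIT certificate: `BSD(E,p)` ⟹
`BranchPAdicGrossZagierMultAt W p Dh` for EVERY (B)-datum `Dh`** — for every admissible
`(V, C, f, B, ϖ)`: `ord_p(ϖ·[T¹]B·log_p γ) = 0 + 1` (certificate), `ord_p(q·Reg_p(E,Dh)) = 1` (`BSD(E,p)`
through p07's criterion, `q := #Ш_an·∏c/#T²`, Schneider from p07 §4), so the quotient is a unit of
`ℤ_p`. CERT version: NO `QuadraticBranchLowerDivisibilityAt` (p01's IMC-version converse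
`ClassX4M.branchPAdicGrossZagierMultAt_of_bsdp_of_quadraticBranchLower_of_katoHalf` takes the branch
main conjecture instead of the certificate). [cite: Kato2004Asterisque, Thm. 17.4 (3) (p. 273)]
[cite: Delbourgo2002, Theorem (B) (p. 40)] [cite: PerrinRiou1987, §1.4 (shape)] [cite: Miller2011LMS, Def. 1.1] -/
theorem ClassX4M.branchPAdicGrossZagierMultAt_of_bsdp_of_katoHalf_of_multCert
    (hK : Wuthrich2014.kato_halfEigenCharIdeal_dvd_cyclotomicPrime_of_surjective)
    (hmodD : nonempty_modularParametrizationData)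
    (hGZK : rank_eq_analyticRank_of_analyticRank_le_one) (hmod : hasEntireLFunction_rat)
    (hX : ClassX4M W p) (hsurj : Surj W p) (hr : W.analyticRank = 1)
    (hcert : MultBranchUnitCertificateAt W p) (hbsd : BSDp W p)
    {Dh : PAdicHeightData W p} (hB : LeadingTermClauses W p Dh) :
    BranchPAdicGrossZagierMultAt W p Dh := by
  -- rank-one bookkeeping and Schneider (p07 §4)
  obtain ⟨hmw, hfinSha⟩ := hGZK W (by rw [hr])
  have hr1 : W.mordellWeilRank = 1 := by rw [hmw, hr]
  haveI : Finite W.sha := hfinSha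
  have hReg : padicRegulator Dh ≠ 0 :=
    (hX.schneider_and_padicVal_identity_rankOne_of_katoHalf_of_multCert hK hmodD hGZK hsurj hr hcert
      hB).1
  intro V iV iVm N _ f B hp2 hVW hVB hf ϖ hϖ
  obtain ⟨C, hC⟩ := hVW
  -- the certificate on this admissible datum
  obtain ⟨hx0, hxv⟩ := CensusX42.valuation_eq_zero_of_norm_eq_one (p := p)
    (norm_coeff_one_eq_one_of_multCert_of_disj hcert V C hC hf B hVB ϖ hϖ)
  -- `q` with `L'(E,1) = q·Ω_E·Reg_∞` from the rationality of `#Ш_an` under `BSD(E,p)`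
  obtain ⟨s, hs, -⟩ := missingPPartAt_of_bsdp W p hbsd
  have hΩpos : 0 < W.realPeriodRat := W.realPeriodRat_pos_holds
  have hT0 : W.torsionOrder ≠ 0 := (W.torsionOrder_pos_holds).ne'
  have hPpos : 0 < W.tamagawaProduct := W.tamagawaProduct_pos_holds
  have hRpos : 0 < W.regulator := regulator_pos_holds W
  set q : ℚ := s * (W.tamagawaProduct : ℚ) / (W.torsionOrder : ℚ) ^ 2 with hq_def
  have hLq : W.leadingLCoeff = (q : ℂ) * (W.realPeriodRat : ℂ) * (W.regulator : ℂ) := by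
    have hΩC : (W.realPeriodRat : ℂ) ≠ 0 := by exact_mod_cast hΩpos.ne'
    have hTC : (W.torsionOrder : ℂ) ≠ 0 := by exact_mod_cast hT0
    have hPC : (W.tamagawaProduct : ℂ) ≠ 0 := by exact_mod_cast hPpos.ne'
    have hRC : (W.regulator : ℂ) ≠ 0 := by exact_mod_cast hRpos.ne'
    have h := hs
    rw [shaAn_def, div_eq_iff (mul_ne_zero (mul_ne_zero hΩC hPC) hRC)] at h
    rw [hq_def]
    push_cast
    field_simp
    linear_combination h
  -- p07 §5: `ord_p q + ord_p Reg_p(Dh) = 1`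
  have hvq : padicValRat p q + (padicRegulator Dh).valuation = 1 :=
    (hX.bsdp_iff_padicVal_rankOne_of_katoHalf_of_multCert hK hmodD hGZK hmod hsurj hr hcert hB hLq).mp
      hbsd
  have hq0 : q ≠ 0 := by
    intro h0
    rw [h0, Rat.cast_zero, zero_mul, zero_mul] at hLq
    exact W.leadingLCoeff_ne_zero_holds (hmod W) hLq
  have hqQ : ((q : ℚ) : ℚ_[p]) ≠ 0 := by exact_mod_cast hq0
  obtain ⟨hlog0, hlogv⟩ := X2.valuation_padicLog_cyclotomicGenerator (p := p) hp2
  -- the quotient `(ϖ[T¹]B·log γ)/(q·Reg_p)` is a unit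
  set num : ℚ_[p] := ((ϖ : ℚ) : ℚ_[p]) * PowerSeries.coeff 1 B * padicLog p (cyclotomicGenerator p)
    with hnum
  set den : ℚ_[p] := ((q : ℚ) : ℚ_[p]) * padicRegulator Dh with hden
  have hnum0 : num ≠ 0 := mul_ne_zero hx0 hlog0
  have hden0 : den ≠ 0 := mul_ne_zero hqQ hReg
  have hnumv : num.valuation = 1 := by
    rw [hnum, Padic.valuation_mul hx0 hlog0, hxv, hlogv, zero_add]
  have hdenv : den.valuation = 1 := by
    rw [hden, Padic.valuation_mul hqQ hReg, Padic.valuation_ratCast]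
    exact hvq
  have hcancel : num / den * den = num := div_mul_cancel₀ num hden0
  have hxval : (num / den).valuation = 0 := by
    have hv := congrArg Padic.valuation hcancel
    rw [Padic.valuation_mul (div_ne_zero hnum0 hden0) hden0, hnumv, hdenv] at hv
    linarith
  obtain ⟨u, hu⟩ := exists_units_coe_eq_of_valuation_eq_zero (div_ne_zero hnum0 hden0) hxval
  refine ⟨u, q, hLq, ?_⟩
  rw [hr1, pow_one, hu]
  simp only [hnum, hden] at hcancel ⊢
  linear_combination -hcancel

/-! ### §3 On the unit-certified (M) rows the typed `p`-adic Gross–Zagier IS `BSD(E,p)` -/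

omit [W.IsGloballyMinimal] in
/-- **X4(M) ∩ {`ρ̄_{E,p}` onto}, EVERY odd `p` (`p = 3` included), `r_an = 1`, UNIT certificate, `Dh` a
(B)-datum: `BranchPAdicGrossZagierMultAt W p Dh ↔ BSDp W p`.** The typed (M) `p`-adic Gross–Zagier
formula at the additive prime (RESIDUAL-MAP §I O7-ord (M) share, OPEN in rank one) and the `p`-part of
BSD are ONE statement on these rows — given Kato's half (published) and p07's one-number certificate
(EVIDENCE). Nothing booked; O7 OPEN. [cite: Kato2004Asterisque, Thm. 17.4 (3) (p. 273)]
[cite: Delbourgo2002, Theorem (B) (p. 40)] [cite: Delbourgo1998, Thm. 1 (shape)] [cite: Miller2011LMS, Def. 1.1] -/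
theorem ClassX4M.branchPAdicGrossZagierMultAt_iff_bsdp_of_katoHalf_of_multCert
    (hK : Wuthrich2014.kato_halfEigenCharIdeal_dvd_cyclotomicPrime_of_surjective)
    (hmodD : nonempty_modularParametrizationData)
    (hGZK : rank_eq_analyticRank_of_analyticRank_le_one) (hmod : hasEntireLFunction_rat)
    (hX : ClassX4M W p) (hsurj : Surj W p) (hr : W.analyticRank = 1)
    (hcert : MultBranchUnitCertificateAt W p)
    {Dh : PAdicHeightData W p} (hB : LeadingTermClauses W p Dh) :
    BranchPAdicGrossZagierMultAt W p Dh ↔ BSDp W p :=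
  ⟨fun hGZ ↦ hX.bsdp_rankOne_of_katoHalf_of_multCert_of_branchPAdicGrossZagierMult hK hmodD hGZK hmod
      hsurj hr hcert hB hGZ,
    fun hbsd ↦ hX.branchPAdicGrossZagierMultAt_of_bsdp_of_katoHalf_of_multCert hK hmodD hGZK hmod hsurj
      hr hcert hbsd hB⟩

omit [W.IsGloballyMinimal] in
/-- **`∀ Dh` form**: on the unit-certified X4(M) ∧ surj ∧ `r_an = 1` rows, every odd `p`, for EVERY
(B)-datum `Dh`: `BranchPAdicGrossZagierMultAt W p Dh ↔ BSDp W p`. [cite: Miller2011LMS, Def. 1.1] -/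
theorem ClassX4M.forall_branchPAdicGrossZagierMultAt_iff_bsdp_of_katoHalf_of_multCert
    (hK : Wuthrich2014.kato_halfEigenCharIdeal_dvd_cyclotomicPrime_of_surjective)
    (hmodD : nonempty_modularParametrizationData)
    (hGZK : rank_eq_analyticRank_of_analyticRank_le_one) (hmod : hasEntireLFunction_rat)
    (hX : ClassX4M W p) (hsurj : Surj W p) (hr : W.analyticRank = 1)
    (hcert : MultBranchUnitCertificateAt W p) :
    ∀ Dh : PAdicHeightData W p, LeadingTermClauses W p Dh →
      (BranchPAdicGrossZagierMultAt W p Dh ↔ BSDp W p) :=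
  fun _ hB ↦ hX.branchPAdicGrossZagierMultAt_iff_bsdp_of_katoHalf_of_multCert hK hmodD hGZK hmod hsurj hr
    hcert hB

/-! ### §4 With Delbourgo 2002 (M) supplying the (B)-datum -/

/-- **X4(M) ∩ {`ρ̄_{E,p}` onto}, EVERY odd `p`, `r_an = 1`, UNIT certificate, WITH Delbourgo 2002 (M)
(`hDelM`, every hypothesis discharged on (M) by n1011-p16's `ClassX4M.delbourgo2002`; no CM binder):
`BSD(E,p) ↔ (∀ (B)-datum Dh, BranchPAdicGrossZagierMultAt W p Dh)`.** (⟹ §2 for every `Dh`; ⟸: A190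
supplies one (B)-datum, §1.) [cite: Delbourgo2002, Theorem (A), (B) (p. 40)]
[cite: Kato2004Asterisque, Thm. 17.4 (3) (p. 273)] [cite: Miller2011LMS, Def. 1.1] -/
theorem ClassX4M.bsdp_iff_forall_branchPAdicGrossZagierMultAt_of_katoHalf_of_multCert
    (hDelM : Delbourgo2002.mainTheorem_potMult)
    (hK : Wuthrich2014.kato_halfEigenCharIdeal_dvd_cyclotomicPrime_of_surjective)
    (hmodD : nonempty_modularParametrizationData)
    (hGZK : rank_eq_analyticRank_of_analyticRank_le_one) (hmod : hasEntireLFunction_rat)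
    (hX : ClassX4M W p) (hsurj : Surj W p) (hr : W.analyticRank = 1)
    (hcert : MultBranchUnitCertificateAt W p) :
    BSDp W p ↔ ∀ Dh : PAdicHeightData W p, LeadingTermClauses W p Dh →
      BranchPAdicGrossZagierMultAt W p Dh := by
  refine ⟨fun hbsd Dh hB ↦ hX.branchPAdicGrossZagierMultAt_of_bsdp_of_katoHalf_of_multCert hK hmodD
    hGZK hmod hsurj hr hcert hbsd hB, fun h ↦ ?_⟩
  obtain ⟨-, Dh, hB⟩ := hX.delbourgo2002 hDelM
  exact hX.bsdp_rankOne_of_katoHalf_of_multCert_of_branchPAdicGrossZagierMult hK hmodD hGZK hmod hsurj hr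
    hcert hB (h Dh hB)

/-- **`∃` form**: same rows, WITH Delbourgo 2002 (M): `BSD(E,p) ↔ ∃ Dh, LeadingTermClauses W p Dh ∧
BranchPAdicGrossZagierMultAt W p Dh` — the typed (M) pGZ for ONE (B)-datum is exactly the missing
analytic input. [cite: Delbourgo2002, Theorem (A), (B) (p. 40)] [cite: Miller2011LMS, Def. 1.1] -/
theorem ClassX4M.bsdp_iff_exists_branchPAdicGrossZagierMultAt_of_katoHalf_of_multCert
    (hDelM : Delbourgo2002.mainTheorem_potMult)
    (hK : Wuthrich2014.kato_halfEigenCharIdeal_dvd_cyclotomicPrime_of_surjective)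
    (hmodD : nonempty_modularParametrizationData)
    (hGZK : rank_eq_analyticRank_of_analyticRank_le_one) (hmod : hasEntireLFunction_rat)
    (hX : ClassX4M W p) (hsurj : Surj W p) (hr : W.analyticRank = 1)
    (hcert : MultBranchUnitCertificateAt W p) :
    BSDp W p ↔ ∃ Dh : PAdicHeightData W p, LeadingTermClauses W p Dh ∧
      BranchPAdicGrossZagierMultAt W p Dh := by
  refine ⟨fun hbsd ↦ ?_, fun ⟨Dh, hB, hGZ⟩ ↦
    hX.bsdp_rankOne_of_katoHalf_of_multCert_of_branchPAdicGrossZagierMult hK hmodD hGZK hmod hsurj hr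
      hcert hB hGZ⟩
  obtain ⟨-, Dh, hB⟩ := hX.delbourgo2002 hDelM
  exact ⟨Dh, hB, hX.branchPAdicGrossZagierMultAt_of_bsdp_of_katoHalf_of_multCert hK hmodD hGZK hmod hsurj
    hr hcert hbsd hB⟩

/-! ### §5 Headline from ONE number (the certificate via p07's §7; `hPal` carried as there) -/

/-- **HEADLINE (X4(M) ∩ {`ρ̄_{E,p}` onto}, EVERY odd `p`, `r_an = 1`, `Dh` a (B)-datum):
`BranchPAdicGrossZagierMultAt W p Dh ↔ BSDp W p`, GIVEN Kato's divisibility and ONE `p`-adic unit** —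
the linear coefficient of the Néron-normalised multiplicative branch of `E♭` (`hone`; the constant
term `0` is a THEOREM when `L(E,1) = 0`, p07's `multBranchUnitCertificateAt_of_norm_coeff_one`, with
Pal 2012 Thm. 3.2 `hPal` carried for its uniform signature). All other inputs published (Kato 17.4 (3)
half-eigen reading `hK`, GZK, modularity) or kernel. [cite: Kato2004Asterisque, Thm. 17.4 (3) (p. 273)]
[cite: Delbourgo2002, Theorem (B) (p. 40)] [cite: Pal2012, Thm. 3.2] [cite: Miller2011LMS, Def. 1.1] -/
theorem ClassX4M.branchPAdicGrossZagierMultAt_iff_bsdp_of_katoHalf_of_norm_coeff_one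
    (hK : Wuthrich2014.kato_halfEigenCharIdeal_dvd_cyclotomicPrime_of_surjective)
    (hPal : Pal2012.thm32_sqrt_mul_realPeriodRat_twist_eq_of_prime_one_mod_four)
    (hmodD : nonempty_modularParametrizationData)
    (hGZK : rank_eq_analyticRank_of_analyticRank_le_one) (hmod : hasEntireLFunction_rat)
    (hX : ClassX4M W p) (hsurj : Surj W p) (hr : W.analyticRank = 1)
    (hone : ∀ (V : WeierstrassCurve ℚ) [V.IsElliptic] [V.IsGloballyMinimal] (C : VariableChange ℚ),
      Mult V p → C • V.quadraticTwist ((-1 : ℚ) ^ (p / 2) * p) = W →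
      ∀ {N : ℕ} [NeZero N] (f : CuspForm (Gamma0 N) 2), IsNewformOf V f → ∀ (ap : ℤ), cuspCoeff f p = ap →
      ∀ ϖ : ℚ, (if Even (p / 2) then (ϖ : ℝ) * V.realPeriodRat = plusPeriod f
          else (ϖ : ℝ) * V.imaginaryPeriodRat = minusPeriod f) →
        ‖PowerSeries.coeff 1 (PowerSeries.C (ϖ : ℚ_[p]) *
            (if Even (p / 2) then padicLFunctionPlusBranchMult f (ap : ℚ_[p]) (p / 2)
              else padicLFunctionMinusBranchMult f (ap : ℚ_[p]) (p / 2)))‖ = 1)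
    {Dh : PAdicHeightData W p} (hB : LeadingTermClauses W p Dh) :
    BranchPAdicGrossZagierMultAt W p Dh ↔ BSDp W p :=
  hX.branchPAdicGrossZagierMultAt_iff_bsdp_of_katoHalf_of_multCert hK hmodD hGZK hmod hsurj hr
    (multBranchUnitCertificateAt_of_norm_coeff_one hPal hmod hX.p_ne_two hX.classX4.2.1
      (entireLFunction_one_eq_zero_of_analyticRank_ne_zero hmod (by rw [hr]; exact one_ne_zero)) hone)
    hB

end Summit.BirchSwinnertonDyer.Rank1Residual.AdditivePotMult

end
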